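import Summits.Parity.GeneralizedHardyLittlewood.Theses.LeeYangFibres
import Summits.Parity.GeneralizedHardyLittlewood.Theorems.LeeYangFibresCellParityLawDefs
import Summits.Parity.GeneralizedHardyLittlewood.Theorems.LeeYangFibresCellParityLawModelDensityBounds
import Summits.Parity.GeneralizedHardyLittlewood.Theorems.LeeYangFibresCellParityLawSingularRatio
import Summits.Parity.GeneralizedHardyLittlewood.Theorems.LeeYangFibresCellParityLawWalshStep
import Summits.Parity.GeneralizedHardyLittlewood.Theorems.LeeYangFibresCellParityLawBase
import HarnessLib

/-!
# Route `LeeYangFibres`, crux `CellParityLaw` (stmt-Parity-14109), line `section-annihilator`: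
# the reduction of the crux to Bombieri's one-parameter section law (registered stub `stub_reduction`)

**Theorem (sorry-free).** If for every `t ≥ 1` the coordinate sections of every non-degenerate `(t+1)`-form
one-dimensional system obey Bombieri's one-parameter parity law with effective error (`SectionLawAt t`, vocabulary
file `LeeYangFibresCellParityLawDefs`: for each section one free `δ ∈ [0,2]`, cells
`= (1 + (δ-1)(-1)^m) · a_m · (𝔖/𝔖₋ᵢ) · F + O(N/(log^{t+1}N (log log N)^B))` for every `B`), then the multi-character
cell-parity law `LeeYangFibres.CellParityLaw` holds: `C_j = W_θ(σ(j)) · β_∞ 𝔖 ∏ A_{j_i}(N)/N + O(ε N/log^t N)` with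
`θ_∅ = 1`, `|θ_S| ≤ 2`, uniformly.

Proof. Induction on the number of forms with the LANDED stubs of the line: the base `LawEffAt 1`
(`stub_base`, one progression segment: Siegel–Walfisz + Alladi's cell asymptotics), the step
`LawEffAt t → LawEffAt (t+1)` (`stub_walshStep`: tensor flattening + Walsh inversion with positivity, fed with the
hypothesis `SectionLawAt t`, the anatomy bounds `stub_modelDensityBounds` and the singular-series bookkeeping
`stub_singularRatio`), and finally `B = 1`, `N ≥ exp(exp(1/ε))` to turn `N/(log^t N · log log N)` into `ε N/log^t N`.

What this isolates: the crux is EXACTLY as hard as the one-parameter section law, i.e. as Bombieri's asymptotic sieve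
for the section sequences `b(m) = #{n ∈ K ∩ ℤ : ψ_i(n) = m, ψ_k(n) ∈ cell j'_k (k ≠ i)}` at effective accuracy; the
line's remaining registered stubs supply it from a typed level-of-distribution hypothesis (`stub_sectionLevel`, the
conjectural atom) through the finite-level engine (`stub_sectionBombieri`). Nothing number-theoretic is assumed here.

References: E. Bombieri, *The asymptotic sieve*, Rend. Accad. Naz. XL (5) 1/2 (1975/76) 243–269
[BombieriAsymptoticSieve1976]; E. Bombieri, RIMS Kokyuroku (1977) pp. 3–6 [BombieriRIMS1977]; B. Green, T. Tao,
Ann. of Math. 171 (2010) Conj. 1.4 [GreenTao2010].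
-/

noncomputable section

open scoped BigOperators Classical
open Finset Literature.NumberTheory.Sieve

namespace Summit.Parity.GeneralizedHardyLittlewood.Cruxes.CellParityLaw.SectionAnnihilator

/-- **The reduction statement** (`ReductionStep`; type of the registered stub `stub_reduction`): Bombieri's
one-parameter parity law for the coordinate sections of every `(t+1)`-form system, `t ≥ 1` (`SectionLawAt t`),
implies the crux `LeeYangFibres.CellParityLaw`. -/
def ReductionStep : Prop :=
  (∀ t : ℕ, 1 ≤ t → SectionLawAt t) → Summit.Parity.GeneralizedHardyLittlewood.Theses.LeeYangFibres.CellParityLaw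

/-- The effective law for every number of forms `t ≥ 1` from the section laws: induction on `t` from the landed
base (`stub_base`) through the landed Walsh step (`stub_walshStep`, with `stub_modelDensityBounds` and
`stub_singularRatio`). -/
theorem lawEffAt_of_sectionLaw (hLaw : ∀ t : ℕ, 1 ≤ t → SectionLawAt t) :
    ∀ t : ℕ, 1 ≤ t → LawEffAt t := by
  intro t ht
  induction t, ht using Nat.le_induction with
  | base => exact stub_base
  | succ t ht ih => exact stub_walshStep stub_modelDensityBounds stub_singularRatio t ht (hLaw t ht) ih

/-- **`stub_reduction`** (registered stub, PROVED): `(∀ t ≥ 1, SectionLawAt t) → CellParityLaw`. From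
`lawEffAt_of_sectionLaw` at `B = 1`: for `N ≥ exp(exp(1/ε))` one has `1/log log N ≤ ε`, so the effective budget
`N/(log^t N · log log N)` is within `ε N/log^t N`; the objects of `LawEffAt` are verbatim those of the crux
(`cell`, `walsh`, `modelDensity` unfold definitionally). -/
theorem stub_reduction : ReductionStep := by
  intro hLaw
  have hAll : ∀ t : ℕ, 1 ≤ t → LawEffAt t := lawEffAt_of_sectionLaw hLaw
  intro t L u ht hu ε hε
  obtain ⟨N₀, hN₀⟩ := hAll t ht L u 1 hu
  refine ⟨max N₀ ⌈Real.exp (Real.exp (1 / ε))⌉₊, fun N hN Ψ hΨ hL K hK hKN => ?_⟩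
  have hN₀N : N₀ ≤ N := le_trans (le_max_left _ _) hN
  have hN₁N : (⌈Real.exp (Real.exp (1 / ε))⌉₊ : ℝ) ≤ N := by
    exact_mod_cast le_trans (le_max_right _ _) hN
  have hexpN : Real.exp (Real.exp (1 / ε)) ≤ (N : ℝ) := le_trans (Nat.le_ceil _) hN₁N
  have hlogN : Real.exp (1 / ε) ≤ Real.log N := by
    have := Real.log_le_log (Real.exp_pos _) hexpN
    rwa [Real.log_exp] at this
  have hloglogN : 1 / ε ≤ Real.log (Real.log N) := by
    have := Real.log_le_log (Real.exp_pos _) hlogN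
    rwa [Real.log_exp] at this
  have hε' : 0 < 1 / ε := by positivity
  have hlogpos : 0 < Real.log N := lt_of_lt_of_le (Real.exp_pos _) hlogN
  have hllpos : 0 < Real.log (Real.log N) := lt_of_lt_of_le hε' hloglogN
  obtain ⟨θ, hθ₀, hθS, hθ⟩ := hN₀ N hN₀N Ψ hΨ hL K hK hKN
  refine ⟨θ, hθ₀, hθS, fun j hj => le_trans (hθ j hj) ?_⟩
  have hpow : 0 < Real.log N ^ t := pow_pos hlogpos t
  have hinv : 1 / Real.log (Real.log N) ≤ ε := (one_div_le hllpos hε).mpr hloglogN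
  have hNn : 0 ≤ (N : ℝ) / Real.log N ^ t := div_nonneg (Nat.cast_nonneg N) hpow.le
  calc (N : ℝ) / (Real.log N ^ t * Real.log (Real.log N) ^ 1)
      = (N : ℝ) / Real.log N ^ t * (1 / Real.log (Real.log N)) := by
        rw [pow_one, div_mul_eq_div_div, div_eq_mul_one_div ((N : ℝ) / Real.log N ^ t)]
    _ ≤ (N : ℝ) / Real.log N ^ t * ε := mul_le_mul_of_nonneg_left hinv hNn
    _ = ε * N / Real.log N ^ t := by ring

/-- Corollary in the shape of the skeleton: the crux from the atom and the engine (both still open), through the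
proved reduction. -/
theorem cellParityLaw_of_atom_of_engine
    (hAtom : ∀ t : ℕ, 1 ≤ t → SectionLevelAt t)
    (hEngine : ∀ t : ℕ, 1 ≤ t → SectionLevelAt t → SectionLawAt t) :
    Summit.Parity.GeneralizedHardyLittlewood.Theses.LeeYangFibres.CellParityLaw :=
  stub_reduction (fun t ht => hEngine t ht (hAtom t ht))

end Summit.Parity.GeneralizedHardyLittlewood.Cruxes.CellParityLaw.SectionAnnihilator

end
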